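import Literature.MathematicalPhysics.KineticTheory.HardSphereEulerLLN
import Literature.Analysis.Asymptotics.StepRatioRiemannSum

/-!
# From insertion ratios to the canonical free energy of hard spheres

Stub `stub_eosCesaro` (E2b) of the line `log-lipschitz-budget` for the crux
`ImplosionDichotomy.PolynomialCompression` (item stmt-AtomisticToContinuum-12587).

If the insertion ratios `q_N(m) = Ξ_N(m)/Ξ_N(m+1)` of `N + 1` uniform hard spheres of diameter
`ε_N = η^{1/3}(N+1)^{-1/3}` on `𝕋³` converge to `Rf(η m/(N+1))` uniformly in the level `m ≤ N`
(the conclusion of stub E2a, a hypothesis here), then the canonical free energy per particle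
converges: `−N⁻¹ log hsFreeVolume η N → ∫₀¹ log Rf(η s) ds`.

* Matching (`EosCesaro.hsFreeVolume_succ_eq_XiN`): `hsFreeVolume η (N+1)` (strict non-overlap of
  `N + 1` spheres of diameter `(η/(N+1))^{1/3}`) equals the canonical partition function
  `XiN uniformProfile (η^{1/3}) N (N+1)` (non-strict non-overlap): the two sets differ by the
  contact configurations `{dist(qᵢ, qⱼ) = ε}`, which are Haar-null (Fubini over one particle and
  `Torus.volume_euclidDist_eq`; at `ε = 0` the diagonal, a point section).
* Telescoping: `Ξ_N(0) = 1`, so `−log Ξ_N(N+1) = ∑_{m ≤ N} log q_N(m)` as soon as all `q_N(m) > 0`,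
  which the hypothesis (with `δ = 1/2`, `Rf ≥ 1`) gives eventually — no smallness of `η` is used.
* Comparison `|log q − log R| ≤ 2|q − R|` for `q, R ≥ 1/2`, and the Riemann sums of the continuous
  `s ↦ log Rf(ηs)` on `[0, 1]` (`Literature.Analysis.Asymptotics.tendsto_mul_sum_range_intervalIntegral`
  applied to a continuous extension); finally the index shift `N + 1 → N`.
* At `η = 0` the free volume is `1` (diagonals are null) and the limit is `log Rf(0) = 0`.
-/

namespace Summit.AtomisticToContinuum.HydrodynamicLimit.Theorems

open Set MeasureTheory Filter Topology
open scoped ENNReal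
open Literature.MathematicalPhysics.KineticTheory
open Literature.Analysis.FunctionSpaces

namespace EosCesaro

/-! ### Contact sets are null; the free volume as a canonical partition function -/

/-- Minimal-image spheres and points of `𝕋³` are Haar-null: `vol {x | dist(x, y) = r} = 0` for
every `r` (for `r ≠ 0` a Euclidean sphere read through the chart, `Torus.volume_euclidDist_eq`;
for `r = 0` the point `{y}`). [folklore] -/
theorem volume_setOf_euclidDist_eq_zero (r : ℝ) (y : T3) :
    volume {x : T3 | Literature.Analysis.FluidPDE.Torus.euclidDist x y = r} = 0 := by
  rcases eq_or_ne r 0 with rfl | hr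
  · haveI := Literature.Analysis.FluidPDE.nullSingletonClass_volume_unitAddTorus (Fin 3)
    refine measure_mono_null (fun x hx => ?_) (measure_singleton y)
    rw [Set.mem_setOf_eq, Literature.Analysis.FluidPDE.Torus.euclidDist_eq, norm_eq_zero] at hx
    have h := congrArg Literature.Analysis.FunctionSpaces.Torus.proj hx
    rw [Literature.Analysis.FluidPDE.Torus.proj_reprSym,
      Literature.Analysis.FunctionSpaces.Torus.proj_zero, sub_eq_zero] at h
    exact Set.mem_singleton_iff.2 h
  · exact Literature.Analysis.FluidPDE.Torus.volume_euclidDist_eq hr y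

/-- For two distinct labels `i ≠ j`, the configurations of `n` points of `𝕋³` with
`dist(qᵢ, qⱼ) = r` are Haar-null (Fubini over the coordinate `qᵢ`: every section is a
minimal-image sphere or a point). [folklore] -/
theorem volume_setOf_euclidDist_apply_eq_zero {n : ℕ} {i j : Fin n} (hij : i ≠ j) (r : ℝ) :
    volume {q : Fin n → T3 | Literature.Analysis.FluidPDE.Torus.euclidDist (q i) (q j) = r} = 0 := by
  set S : Set (Fin n → T3) :=
    {q | Literature.Analysis.FluidPDE.Torus.euclidDist (q i) (q j) = r} with hS_def
  have hS : MeasurableSet S :=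
    (isClosed_eq (continuous_euclidDist_apply i j) continuous_const).measurableSet
  have key : ∫⁻ q, S.indicator 1 q ∂(Measure.pi fun _ : Fin n => (volume : Measure T3)) =
      ∫⁻ _q, (0 : ℝ≥0∞) ∂(Measure.pi fun _ : Fin n => (volume : Measure T3)) := by
    refine lintegral_eq_of_lmarginal_eq {i} (measurable_one.indicator hS) measurable_const ?_
    rw [lmarginal_singleton, lmarginal_singleton]
    funext q
    have hc := continuous_euclidDist_prod.comp
      (continuous_id.prodMk (continuous_const : Continuous fun _ : T3 => q j))
    have hm : MeasurableSet
        {x : T3 | Literature.Analysis.FluidPDE.Torus.euclidDist x (q j) = r} :=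
      (isClosed_eq hc continuous_const).measurableSet
    have hsec : ∀ x : T3, S.indicator (1 : (Fin n → T3) → ℝ≥0∞) (Function.update q i x) =
        {x : T3 | Literature.Analysis.FluidPDE.Torus.euclidDist x (q j) = r}.indicator 1 x := by
      intro x
      simp only [hS_def, Set.indicator_apply, Set.mem_setOf_eq, Function.update_self,
        Function.update_of_ne hij.symm, Pi.one_apply]
    simp_rw [hsec, lintegral_zero]
    rw [lintegral_indicator_one hm]
    exact volume_setOf_euclidDist_eq_zero r (q j)
  have hvol : (volume : Measure (Fin n → T3)) = Measure.pi fun _ => volume := rfl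
  rw [hvol, ← lintegral_indicator_one hS, key, lintegral_zero]

/-- Strict and non-strict non-overlap sets of `n` points of `𝕋³` have the same Haar measure: they
differ by finitely many null contact sets. [folklore] -/
theorem volume_setOf_forall_lt_euclidDist_eq (r : ℝ) (n : ℕ) :
    volume {q : Fin n → T3 | ∀ i j, i ≠ j → r < Literature.Analysis.FluidPDE.Torus.euclidDist (q i) (q j)} =
      volume {q : Fin n → T3 |
        ∀ i j, i ≠ j → r ≤ Literature.Analysis.FluidPDE.Torus.euclidDist (q i) (q j)} := by
  set s : Set (Fin n → T3) :=
    {q | ∀ i j, i ≠ j → r < Literature.Analysis.FluidPDE.Torus.euclidDist (q i) (q j)} with hs_def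
  set t : Set (Fin n → T3) :=
    {q | ∀ i j, i ≠ j → r ≤ Literature.Analysis.FluidPDE.Torus.euclidDist (q i) (q j)} with ht_def
  set D : Set (Fin n → T3) := ⋃ p : Fin n × Fin n,
    {q | p.1 ≠ p.2 ∧ Literature.Analysis.FluidPDE.Torus.euclidDist (q p.1) (q p.2) = r} with hD_def
  have hD : volume D = 0 := by
    refine measure_iUnion_null fun p => ?_
    by_cases hp : p.1 = p.2
    · have he : {q : Fin n → T3 |
          p.1 ≠ p.2 ∧ Literature.Analysis.FluidPDE.Torus.euclidDist (q p.1) (q p.2) = r} = ∅ := by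
        ext q
        simp [hp]
      rw [he, measure_empty]
    · exact measure_mono_null (fun q hq => hq.2) (volume_setOf_euclidDist_apply_eq_zero hp r)
  have hst : s ⊆ t := fun q hq i j hij => (hq i j hij).le
  have hts : t ⊆ s ∪ D := by
    intro q hq
    by_cases h : q ∈ s
    · exact Or.inl h
    · refine Or.inr ?_
      simp only [hs_def, Set.mem_setOf_eq] at h
      push Not at h
      obtain ⟨i, j, hij, hle⟩ := h
      exact Set.mem_iUnion.2 ⟨(i, j), hij, le_antisymm hle (hq i j hij)⟩
  refine le_antisymm (measure_mono hst) ?_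
  calc volume t ≤ volume (s ∪ D) := measure_mono hts
    _ ≤ volume s + volume D := measure_union_le s D
    _ = volume s := by rw [hD, add_zero]

/-- The free volume of `n` spheres of diameter `(η/n)^{1/3}` is the Haar measure of the NON-STRICT
non-overlap set `posDomain ((η/n)^{1/3}) n`. [folklore] -/
theorem hsFreeVolume_eq_toReal (η : ℝ) (n : ℕ) :
    hsFreeVolume η n = (volume (posDomain ((η / n) ^ (1 / 3 : ℝ)) n)).toReal := by
  rw [hsFreeVolume, volume_setOf_forall_lt_euclidDist_eq]
  rfl

/-- At `η = 0` the free volume is `1`: the diagonals are null. [folklore] -/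
theorem hsFreeVolume_zero (n : ℕ) : hsFreeVolume 0 n = 1 := by
  rw [hsFreeVolume_eq_toReal, zero_div, Real.zero_rpow (by norm_num : (1 / 3 : ℝ) ≠ 0)]
  have h : posDomain 0 n = Set.univ := by
    simp only [posDomain, Set.eq_univ_iff_forall, Set.mem_setOf_eq]
    intro q i j _
    exact norm_nonneg _
  rw [h, measure_univ, ENNReal.toReal_one]

/-- **Matching.** For `η ≥ 0` the free volume of `N + 1` spheres of diameter `(η/(N+1))^{1/3}`
(strict non-overlap) is the canonical partition function `Ξ_N(N+1)` of `N + 1` uniform hard spheres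
of diameter `hsDiameter (η^{1/3}) N = η^{1/3}(N+1)^{-1/3}` (non-strict non-overlap). [folklore] -/
theorem hsFreeVolume_succ_eq_XiN {η : ℝ} (hη : 0 ≤ η) (N : ℕ) :
    hsFreeVolume η (N + 1) = XiN uniformProfile (η ^ (1 / 3 : ℝ)) N (N + 1) := by
  have hμ : uniformProfile.μ = (volume : Measure T3) := by
    simp only [DensityProfile.μ, uniformProfile, ENNReal.ofReal_one]
    rw [withDensity_const, one_smul]
  have hN : (0 : ℝ) ≤ ((N + 1 : ℕ) : ℝ) := by positivity
  have hε : (η / ((N + 1 : ℕ) : ℝ)) ^ (1 / 3 : ℝ) = hsDiameter (η ^ (1 / 3 : ℝ)) N := by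
    rw [hsDiameter, Real.div_rpow hη hN, Real.rpow_neg hN, div_eq_mul_inv]
  rw [hsFreeVolume_eq_toReal, XiN, Xi, Literature.MathematicalPhysics.StatisticalMechanics.hcProb,
    firstLabels_self, hardCoreSet_ov_univ, measureReal_def, hμ, hε]
  rfl

/-! ### Two elementary real-variable facts -/

/-- `|log a − log b| ≤ 2|a − b|` for `a, b ≥ 1/2` (the logarithm is `2`-Lipschitz on `[1/2, ∞)`,
from `log x ≤ x − 1`). [folklore] -/
theorem abs_log_sub_log_le_two_mul {a b : ℝ} (ha : 1 / 2 ≤ a) (hb : 1 / 2 ≤ b) :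
    |Real.log a - Real.log b| ≤ 2 * |a - b| := by
  have key : ∀ {c d : ℝ}, 1 / 2 ≤ c → 1 / 2 ≤ d → Real.log d - Real.log c ≤ 2 * |d - c| := by
    intro c d hc hd
    have hc0 : 0 < c := by linarith
    have hd0 : 0 < d := by linarith
    have h1 : Real.log d - Real.log c ≤ d / c - 1 := by
      rw [← Real.log_div hd0.ne' hc0.ne']
      exact Real.log_le_sub_one_of_pos (div_pos hd0 hc0)
    have h2 : d / c - 1 = (d - c) / c := by field_simp
    have h3 : (d - c) / c ≤ 2 * |d - c| :=
      calc (d - c) / c ≤ |d - c| / c := div_le_div_of_nonneg_right (le_abs_self _) hc0.le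
        _ ≤ |d - c| / (1 / 2) := div_le_div_of_nonneg_left (abs_nonneg _) (by norm_num) hc
        _ = 2 * |d - c| := by ring
    linarith
  rw [abs_le]
  constructor
  · have h := key ha hb
    rw [abs_sub_comm] at h
    linarith
  · have h := key hb ha
    linarith

/-- **Telescoping.** If all insertion ratios `q_N(m)`, `m ≤ N`, are at least `1/2`, then
`−log Ξ_N(N+1) = ∑_{m ≤ N} log q_N(m)` (`Ξ_N(0) = 1`). [folklore] -/
theorem neg_log_XiN_eq_sum {σ : ℝ} {N : ℕ}
    (hN : ∀ m : ℕ, m ≤ N → 1 / 2 ≤ qN uniformProfile σ N m) :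
    -Real.log (XiN uniformProfile σ N (N + 1)) =
      ∑ m ∈ Finset.range (N + 1), Real.log (qN uniformProfile σ N m) := by
  have hterm : ∀ m ∈ Finset.range (N + 1), Real.log (qN uniformProfile σ N m) =
      Real.log (XiN uniformProfile σ N m) - Real.log (XiN uniformProfile σ N (m + 1)) := by
    intro m hm
    have hqpos : 0 < qN uniformProfile σ N m :=
      lt_of_lt_of_le (by norm_num) (hN m (Nat.lt_succ_iff.1 (Finset.mem_range.1 hm)))
    have hnn : ∀ k, 0 ≤ XiN uniformProfile σ N k := fun k => Xi_nonneg _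
    rw [qN] at hqpos ⊢
    rcases div_pos_iff.1 hqpos with h | h
    · exact Real.log_div h.1.ne' h.2.ne'
    · exact absurd h.1 (not_lt.2 (hnn m))
  have h0 : XiN uniformProfile σ N 0 = 1 := by rw [XiN, Xi_zero]
  rw [Finset.sum_congr rfl hterm,
    Finset.sum_range_sub' (fun m => Real.log (XiN uniformProfile σ N m)), h0, Real.log_one,
    zero_sub]

end EosCesaro

open EosCesaro in
/-- **From insertion ratios to the free energy** (stub `stub_eosCesaro`, E2b, of the line
`log-lipschitz-budget`). Let `Rf` be continuous on `[0, r]` with `1 ≤ Rf ≤ 2` there and `Rf 0 = 1`,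
and let `0 ≤ η < r`. If (for `η > 0`) the insertion ratios `q_N(m) = Ξ_N(m)/Ξ_N(m+1)` of `N + 1`
uniform hard spheres of diameter `η^{1/3}(N+1)^{-1/3}` on `𝕋³` satisfy
`sup_{m ≤ N} |q_N(m) − Rf(η m/(N+1))| → 0`, then the canonical free energy per particle converges:
`−N⁻¹ log hsFreeVolume η N → ∫₀¹ log Rf(η s) ds`. Proof: `hsFreeVolume η (N+1) = Ξ_N(N+1)`
(contact sets are null), `−log Ξ_N(N+1) = ∑_{m ≤ N} log q_N(m)` (telescoping; the hypothesis with
`δ = 1/2` makes all ratios `≥ 1/2`), `|log q − log R| ≤ 2|q − R|`, Riemann sums of the continuous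
`s ↦ log Rf(ηs)`, and the shift `N + 1 → N`; at `η = 0` both sides vanish.
[cite: Ruelle1969, §3.4.3 (4.11)] -/
theorem stub_eosCesaro :
    ∀ (Rf : ℝ → ℝ) (r : ℝ), 0 < r → ContinuousOn Rf (Icc 0 r) → (∀ x ∈ Icc 0 r, 1 ≤ Rf x ∧ Rf x ≤ 2) →
      Rf 0 = 1 →
      ∀ η : ℝ, 0 ≤ η → η < r →
        (0 < η → ∀ δ : ℝ, 0 < δ → ∀ᶠ N : ℕ in atTop, ∀ m : ℕ, m ≤ N →
          |qN uniformProfile (η ^ (1 / 3 : ℝ)) N m - Rf (η * m / (N + 1))| ≤ δ) →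
        Tendsto (fun N : ℕ => -(N : ℝ)⁻¹ * Real.log (hsFreeVolume η N)) atTop
          (nhds (∫ s in (0 : ℝ)..1, Real.log (Rf (η * s)))) := by
  intro Rf r _hr hcont hbd h0 η hη0 hηr hq
  rcases hη0.eq_or_lt with hη | hη
  · -- `η = 0`: the free volume is `1` and the integrand is `log Rf(0) = 0`
    subst hη
    simp only [hsFreeVolume_zero, Real.log_one, mul_zero, zero_mul, h0,
      intervalIntegral.integral_zero]
    exact tendsto_const_nhds
  -- `η > 0`
  have hq' := hq hη
  generalize hσ : η ^ (1 / 3 : ℝ) = σ at hq'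
  -- the nodes `η m/(N+1)`, `m ≤ N`, lie in `[0, r]`
  have hx : ∀ N m : ℕ, m ≤ N → η * m / (N + 1) ∈ Icc (0 : ℝ) r := by
    intro N m hm
    have hN1 : (0 : ℝ) < N + 1 := by positivity
    refine ⟨by positivity, ?_⟩
    have hmN : (m : ℝ) / (N + 1) ≤ 1 := by
      rw [div_le_one hN1]
      exact_mod_cast Nat.le_succ_of_le hm
    calc η * m / (N + 1) = η * (m / (N + 1)) := mul_div_assoc _ _ _
      _ ≤ η * 1 := mul_le_mul_of_nonneg_left hmN hη.le
      _ = η := mul_one η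
      _ ≤ r := hηr.le
  -- eventually all ratios are `≥ 1/2` (hypothesis with `δ = 1/2`, `Rf ≥ 1`)
  have hhalf : ∀ᶠ N : ℕ in atTop, ∀ m : ℕ, m ≤ N → 1 / 2 ≤ qN uniformProfile σ N m := by
    filter_upwards [hq' (1 / 2) (by norm_num)] with N hN m hm
    have h1 := (hbd _ (hx N m hm)).1
    have h2 := hN m hm
    rw [abs_le] at h2
    linarith [h2.1]
  -- the integrand `g(s) = log Rf(ηs)` is continuous on `[0, 1]`; extend it continuously to `ℝ`
  have hmaps : MapsTo (fun s : ℝ => η * s) (Icc (0 : ℝ) 1) (Icc 0 r) := by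
    intro s hs
    exact ⟨by nlinarith [hs.1, hη], by nlinarith [hs.2, hη, hηr]⟩
  have hg : ContinuousOn (fun s : ℝ => Real.log (Rf (η * s))) (Icc 0 1) := by
    have hRf : ContinuousOn (fun s : ℝ => Rf (η * s)) (Icc 0 1) :=
      hcont.comp (continuous_const.mul continuous_id).continuousOn hmaps
    exact hRf.log fun s hs => (lt_of_lt_of_le one_pos (hbd _ (hmaps hs)).1).ne'
  obtain ⟨G, hGc, hGeq⟩ : ∃ G : ℝ → ℝ, Continuous G ∧
      EqOn G (fun s : ℝ => Real.log (Rf (η * s))) (Icc 0 1) :=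
    ⟨IccExtend zero_le_one ((Icc (0 : ℝ) 1).restrict fun s : ℝ => Real.log (Rf (η * s))),
      (continuousOn_iff_continuous_restrict.1 hg).Icc_extend',
      fun s hs => IccExtend_of_mem _ _ hs⟩
  -- Riemann sums of `G` with mesh `1/(N+1)`
  have hmesh : Tendsto (fun N : ℕ => 1 / ((N : ℝ) + 1)) atTop (𝓝[>] 0) :=
    tendsto_nhdsWithin_iff.2 ⟨tendsto_one_div_add_atTop_nhds_zero_nat,
      Eventually.of_forall fun N => Set.mem_Ioi.2 (by positivity)⟩
  have hNh : Tendsto (fun N : ℕ => ((N + 1 : ℕ) : ℝ) * (1 / ((N : ℝ) + 1))) atTop (𝓝 1) := by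
    refine tendsto_const_nhds.congr fun N => ?_
    have hN1 : (N : ℝ) + 1 ≠ 0 := by positivity
    rw [Nat.cast_succ]
    field_simp
  have hB : Tendsto (fun N : ℕ => 1 / ((N : ℝ) + 1) *
      ∑ m ∈ Finset.range (N + 1), G (m * (1 / ((N : ℝ) + 1)))) atTop
      (𝓝 (∫ s in (0 : ℝ)..1, G s)) :=
    Literature.Analysis.Asymptotics.tendsto_mul_sum_range_intervalIntegral
      (N := fun N : ℕ => N + 1) (h := fun N : ℕ => 1 / ((N : ℝ) + 1)) hGc zero_le_one hmesh hNh
  have hint : ∫ s in (0 : ℝ)..1, G s = ∫ s in (0 : ℝ)..1, Real.log (Rf (η * s)) :=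
    intervalIntegral.integral_congr (by rw [uIcc_of_le zero_le_one]; exact hGeq)
  -- comparison of the two normalised sums: `|log q − log R| ≤ 2|q − R| ≤ 2δ` termwise
  have hAB : ∀ δ : ℝ, 0 < δ → δ ≤ 1 / 2 → ∀ᶠ N : ℕ in atTop,
      |1 / ((N : ℝ) + 1) * ∑ m ∈ Finset.range (N + 1), Real.log (qN uniformProfile σ N m) -
        1 / ((N : ℝ) + 1) * ∑ m ∈ Finset.range (N + 1), G (m * (1 / ((N : ℝ) + 1)))| ≤
        2 * δ := by
    intro δ hδ hδ2
    filter_upwards [hq' δ hδ] with N hN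
    have hN1 : (0 : ℝ) < (N : ℝ) + 1 := by positivity
    have hh : (0 : ℝ) < 1 / ((N : ℝ) + 1) := by positivity
    rw [← mul_sub, ← Finset.sum_sub_distrib, abs_mul, abs_of_pos hh]
    have hterm : ∀ m ∈ Finset.range (N + 1),
        |Real.log (qN uniformProfile σ N m) - G (m * (1 / ((N : ℝ) + 1)))| ≤ 2 * δ := by
      intro m hm
      have hmN : m ≤ N := Nat.lt_succ_iff.1 (Finset.mem_range.1 hm)
      have hnode : (m : ℝ) * (1 / ((N : ℝ) + 1)) ∈ Icc (0 : ℝ) 1 := by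
        refine ⟨by positivity, ?_⟩
        rw [mul_one_div, div_le_one hN1]
        exact_mod_cast Nat.le_succ_of_le hmN
      have hxm : η * ((m : ℝ) * (1 / ((N : ℝ) + 1))) = η * m / (N + 1) := by ring
      have hGm : G (m * (1 / ((N : ℝ) + 1))) = Real.log (Rf (η * m / (N + 1))) := by
        rw [hGeq hnode]
        exact congrArg (fun t => Real.log (Rf t)) hxm
      have hR := hbd _ (hx N m hmN)
      have hqm := hN m hmN
      have hqhalf : 1 / 2 ≤ qN uniformProfile σ N m := by
        rw [abs_le] at hqm
        linarith [hqm.1, hR.1]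
      rw [hGm]
      calc |Real.log (qN uniformProfile σ N m) - Real.log (Rf (η * m / (N + 1)))|
          ≤ 2 * |qN uniformProfile σ N m - Rf (η * m / (N + 1))| :=
            abs_log_sub_log_le_two_mul hqhalf (by linarith [hR.1])
        _ ≤ 2 * δ := by linarith
    calc 1 / ((N : ℝ) + 1) * |∑ m ∈ Finset.range (N + 1),
            (Real.log (qN uniformProfile σ N m) - G (m * (1 / ((N : ℝ) + 1))))|
        ≤ 1 / ((N : ℝ) + 1) * ∑ m ∈ Finset.range (N + 1),
            |Real.log (qN uniformProfile σ N m) - G (m * (1 / ((N : ℝ) + 1)))| :=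
          mul_le_mul_of_nonneg_left (Finset.abs_sum_le_sum_abs _ _) hh.le
      _ ≤ 1 / ((N : ℝ) + 1) * ∑ _m ∈ Finset.range (N + 1), 2 * δ :=
          mul_le_mul_of_nonneg_left (Finset.sum_le_sum hterm) hh.le
      _ = 2 * δ := by
          rw [Finset.sum_const, Finset.card_range, nsmul_eq_mul]
          push_cast
          field_simp
  -- the normalised sums of log-ratios converge to the integral
  have hA : Tendsto (fun N : ℕ => 1 / ((N : ℝ) + 1) *
      ∑ m ∈ Finset.range (N + 1), Real.log (qN uniformProfile σ N m)) atTop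
      (𝓝 (∫ s in (0 : ℝ)..1, Real.log (Rf (η * s)))) := by
    rw [← hint]
    have hdiff : Tendsto (fun N : ℕ =>
        1 / ((N : ℝ) + 1) * ∑ m ∈ Finset.range (N + 1), Real.log (qN uniformProfile σ N m) -
          1 / ((N : ℝ) + 1) * ∑ m ∈ Finset.range (N + 1), G (m * (1 / ((N : ℝ) + 1))))
        atTop (𝓝 0) := by
      rw [Metric.tendsto_nhds]
      intro ε hε
      have hδ : 0 < min (ε / 4) (1 / 2) := lt_min (by positivity) (by norm_num)
      filter_upwards [hAB _ hδ (min_le_right _ _)] with N hN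
      rw [Real.dist_0_eq_abs]
      have h4 : 2 * min (ε / 4) (1 / 2) ≤ ε / 2 := by linarith [min_le_left (ε / 4) (1 / 2)]
      linarith
    have hsum := hdiff.add hB
    simpa only [zero_add, sub_add_cancel] using hsum
  -- undo the shift `N ↦ N + 1` and identify the sequence eventually
  refine (tendsto_add_atTop_iff_nat 1).1 ?_
  refine hA.congr' ?_
  filter_upwards [hhalf] with N hN
  rw [hsFreeVolume_succ_eq_XiN hη.le, hσ, neg_mul, ← mul_neg, neg_log_XiN_eq_sum hN,
    Nat.cast_succ, one_div]

end Summit.AtomisticToContinuum.HydrodynamicLimit.Theorems
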